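import Summits.CriticalPhenomena.Ising3DConformalLimit.Theorems.EnergyNotSigmaSquaredMoebiusLimitExistsLocallyBounded
import HarnessLib

/-!
# Helpers for the reflection-positivity transfer `sepMove_equicontinuity`
(line `only-interaction-breaks-moebius` of the crux `MoebiusLimitExists`, item stmt-CriticalPhenomena-1344,
route `EnergyNotSigmaSquared`; this file is imported by `…SepMove.lean`, which proves the stub)

General lemmas used by the sequential proof of the stub `sepMove_equicontinuity` (asymptotic
equicontinuity of the pinned zoom `F_k = ρ_pin(u k)ᴺ ⟨∏ σ_{[x_j/u k]}⟩_{β_c}` of the critical `ℤ³`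
correlators under moves of one coordinate-separated point):
* floor asymptotics along a mesh sequence (`tendsto_mul_floor_div`), coordinatewise convergence in
  `ℝ³` (`tendsto_euclidean_of_apply`), rescaled coordinates of mirrored lattice points
  (`tendsto_mul_update_apply`);
* the RESCALED TWO-POINT ASYMPTOTICS `ρ_pin(u k)² ⟨σ₀σ_{v k}⟩_{β_c} → ‖r‖^{-2Δ}` when `u k · v k → r ≠ 0`,
  under the two-point law `⟨σ₀σ_y⟩_{β_c}‖y‖₂^{2Δ} → c > 0` (item stmt-0634, passed as data) —
  `tendsto_rhoPin_sq_mul_criticalTwoPoint`, the ratio form of `tendsto_criticalTwoPoint_mul_rpow`;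
* the lattice RP move inequality (statement of `moveIneq_latticeRP`, a hypothesis here) multiplied
  by `ρ_pin^{2(n+1)}` (`sq_rescaled_sub_le_of_move`);
* non-coincidence of the limiting doubled configuration `(θ_∞B₀, B₀)` when the block `B₀` lies on
  one strict side of the continuum mirror (`doubled_mem_nonCoincident`);
* the passage from the sequential to the uniform form of asymptotic equicontinuity on a compact set
  (`equicontinuity_of_seq`: `extraction_forall_of_frequently` + `IsCompact.tendsto_subseq`).

References: J. Fröhlich, R. Israel, E. H. Lieb, B. Simon, Comm. Math. Phys. 62 (1978), §2
[FILS1978]; H. Duminil-Copin, ICM 2022, §8.1 [DuminilCopinICM2022]. No definitions are introduced.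
-/

noncomputable section

open Filter Topology Set Function
open Literature.Probability.LatticeModels

namespace Summit.CriticalPhenomena.Ising3DConformalLimit.MoebiusLimitExistsOnlyInteraction

/-! ### Elementary limits along a mesh sequence -/

/-- `u_k ⌊a_k/u_k⌋ → a₀` when `u_k → 0⁺` and `a_k → a₀` (`|δ⌊a/δ⌋ − a| ≤ δ`). [folklore] -/
theorem tendsto_mul_floor_div {u : ℕ → ℝ} (hu : Tendsto u atTop (𝓝[>] (0 : ℝ))) {a : ℕ → ℝ}
    {a₀ : ℝ} (ha : Tendsto a atTop (𝓝 a₀)) :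
    Tendsto (fun k => u k * (⌊a k / u k⌋ : ℝ)) atTop (𝓝 a₀) := by
  have hu0 : Tendsto u atTop (𝓝 0) := (tendsto_nhdsWithin_iff.1 hu).1
  have hupos : ∀ᶠ k in atTop, 0 < u k := (tendsto_nhdsWithin_iff.1 hu).2
  refine ha.congr_dist (squeeze_zero' (Eventually.of_forall fun k => dist_nonneg) ?_ hu0)
  filter_upwards [hupos] with k hk
  rw [Real.dist_eq, abs_sub_comm, abs_le]
  have h1 : u k * (⌊a k / u k⌋ : ℝ) ≤ a k := by
    have := mul_le_mul_of_nonneg_left (Int.floor_le (a k / u k)) hk.le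
    rwa [mul_div_cancel₀ _ hk.ne'] at this
  have h2 : a k < u k * (⌊a k / u k⌋ : ℝ) + u k := by
    have := mul_lt_mul_of_pos_left (Int.lt_floor_add_one (a k / u k)) hk
    rwa [mul_add, mul_div_cancel₀ _ hk.ne', mul_one] at this
  constructor <;> linarith

/-- Convergence in `ℝ³` is coordinatewise convergence. [folklore] -/
theorem tendsto_euclidean_of_apply {ι : Type*} {l : Filter ι} {f : ι → EuclideanSpace ℝ (Fin 3)}
    {p : EuclideanSpace ℝ (Fin 3)} (h : ∀ q, Tendsto (fun j => f j q) l (𝓝 (p q))) :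
    Tendsto f l (𝓝 p) :=
  ((PiLp.continuous_toLp 2 (fun _ : Fin 3 => ℝ)).tendsto (WithLp.ofLp p)).comp
    (tendsto_pi_nhds.2 h)

/-- Rescaled coordinates of a mirrored lattice point: if `u_j a_j → α` coordinatewise and
`u_j c_j → m₀`, then `u_j θ_j(a_j) → θ_∞(α)` with `θ_j v = (v with v_τ ↦ 2c_j − v_τ)`,
`θ_∞ α = (α with α_τ ↦ 2m₀ − α_τ)`. [folklore] -/
theorem tendsto_mul_update_apply {u : ℕ → ℝ} {a : ℕ → Site 3} {cs : ℕ → ℤ} {α : Fin 3 → ℝ}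
    {m₀ : ℝ} (τ : Fin 3) (ha : ∀ q, Tendsto (fun j => u j * (a j q : ℝ)) atTop (𝓝 (α q)))
    (hcs : Tendsto (fun j => u j * (cs j : ℝ)) atTop (𝓝 m₀)) (q : Fin 3) :
    Tendsto (fun j => u j * ((Function.update (a j) τ (2 * cs j - a j τ)) q : ℝ)) atTop
      (𝓝 (if q = τ then 2 * m₀ - α τ else α q)) := by
  by_cases hq : q = τ
  · subst hq
    simp only [Function.update_self, if_true, Int.cast_sub, Int.cast_mul, Int.cast_ofNat]
    refine ((hcs.const_mul 2).sub (ha q)).congr fun j => ?_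
    ring
  · simp only [Function.update_of_ne hq, if_neg hq]
    exact ha q

/-- **Rescaled two-point asymptotics.** Under the two-point law, along a mesh sequence
`u k → 0⁺`, if `u k · v k → r ≠ 0` coordinatewise then `ρ_pin(u k)² ⟨σ₀σ_{v k}⟩_{β_c} → ‖r‖^{-2Δ}`
(the ratio `⟨σ₀σ_{v k}⟩/⟨σ₀σ_{⌊1/u k⌋e₀}⟩`). [cite: DuminilCopinICM2022, §8.1 eq. (8.1)–(8.2)] -/
theorem tendsto_rhoPin_sq_mul_criticalTwoPoint {Δ c : ℝ} (hc : 0 < c)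
    (hG : Tendsto (fun y : Site 3 => criticalTwoPoint 3 y * Real.sqrt (∑ i, ((y i : ℝ)) ^ 2) ^ (2 * Δ))
      cofinite (𝓝 c))
    {u : ℕ → ℝ} (hu : Tendsto u atTop (𝓝[>] (0 : ℝ))) {v : ℕ → Site 3}
    {r : EuclideanSpace ℝ (Fin 3)} (hr : r ≠ 0)
    (h : ∀ q, Tendsto (fun k => u k * (v k q : ℝ)) atTop (𝓝 (r q))) :
    Tendsto (fun k => rhoPin (u k) ^ 2 * criticalTwoPoint 3 (v k)) atTop
      (𝓝 (‖r‖ ^ (-(2 * Δ)))) := by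
  have hupos : ∀ᶠ k in atTop, 0 < u k := (tendsto_nhdsWithin_iff.1 hu).2
  have hz := tendsto_criticalTwoPoint_mul_rpow (Δ := Δ) hG hu hr h
  have hw := tendsto_criticalTwoPoint_pin_mul_rpow (Δ := Δ) hG hu
  have hq := hz.div hw hc.ne'
  rw [mul_div_assoc, mul_div_left_comm, div_self hc.ne', mul_one] at hq
  refine hq.congr' ?_
  filter_upwards [hupos] with k hk
  rw [Pi.div_apply, mul_div_mul_right _ _ (Real.rpow_pos_of_pos hk _).ne', rhoPin_sq,
    inv_mul_eq_div]

/-! ### The move inequality, rescaled -/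

/-- The lattice move inequality at mesh `δ`, multiplied by `ρ_pin(δ)^{2(n+1)} = ρ² · ρ^{n+n}`:
`(F x − F x')² ≤ [ρ²G(v₀) − 2ρ²G(v₁) + ρ²G(v₂)] · ρ^{n+n}⟨σ_{θB}σ_B⟩`. [cite: FILS1978, §2] -/
theorem sq_rescaled_sub_le_of_move {n : ℕ} (i : Fin (n + 1)) (τ : Fin 3)
    (hMove : ∀ (c : ℤ) (y y' : Fin (n + 1) → Site 3),
      (∀ j, j ≠ i → y' j = y j) →
      ((y i τ ≤ c ∧ y' i τ ≤ c ∧ ∀ j, j ≠ i → c ≤ y j τ) ∨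
        (c ≤ y i τ ∧ c ≤ y' i τ ∧ ∀ j, j ≠ i → y j τ ≤ c)) →
      (criticalCorr 3 (n + 1) y - criticalCorr 3 (n + 1) y') ^ 2 ≤
        (criticalTwoPoint 3 (y i - Function.update (y i) τ (2 * c - y i τ))
          - 2 * criticalTwoPoint 3 (y i - Function.update (y' i) τ (2 * c - y' i τ))
          + criticalTwoPoint 3 (y' i - Function.update (y' i) τ (2 * c - y' i τ))) *
        criticalCorr 3 (n + n)
          (Fin.append (fun j => Function.update (y (i.succAbove j)) τ (2 * c - y (i.succAbove j) τ))
            (fun j => y (i.succAbove j))))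
    (δ : ℝ) (c : ℤ) (x x' : Fin (n + 1) → EuclideanSpace ℝ (Fin 3))
    (hdiff : ∀ l, l ≠ i → x' l = x l)
    (hside : (latticeApprox δ (x i) τ ≤ c ∧ latticeApprox δ (x' i) τ ≤ c ∧
        ∀ l, l ≠ i → c ≤ latticeApprox δ (x l) τ) ∨
      (c ≤ latticeApprox δ (x i) τ ∧ c ≤ latticeApprox δ (x' i) τ ∧
        ∀ l, l ≠ i → latticeApprox δ (x l) τ ≤ c)) :
    (rescaledCorrelator (criticalCorr 3) rhoPin (n + 1) δ x -
        rescaledCorrelator (criticalCorr 3) rhoPin (n + 1) δ x') ^ 2 ≤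
      (rhoPin δ ^ 2 * criticalTwoPoint 3 (latticeApprox δ (x i) -
          Function.update (latticeApprox δ (x i)) τ (2 * c - latticeApprox δ (x i) τ))
        - 2 * (rhoPin δ ^ 2 * criticalTwoPoint 3 (latticeApprox δ (x i) -
          Function.update (latticeApprox δ (x' i)) τ (2 * c - latticeApprox δ (x' i) τ)))
        + rhoPin δ ^ 2 * criticalTwoPoint 3 (latticeApprox δ (x' i) -
          Function.update (latticeApprox δ (x' i)) τ (2 * c - latticeApprox δ (x' i) τ))) *
      (rhoPin δ ^ (n + n) * criticalCorr 3 (n + n)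
        (Fin.append
          (fun l => Function.update (latticeApprox δ (x (i.succAbove l))) τ
            (2 * c - latticeApprox δ (x (i.succAbove l)) τ))
          (fun l => latticeApprox δ (x (i.succAbove l))))) := by
  have hM := hMove c (fun l => latticeApprox δ (x l)) (fun l => latticeApprox δ (x' l))
    (fun l hl => by simp only [hdiff l hl]) hside
  rw [rescaledCorrelator_apply, rescaledCorrelator_apply]
  have h2 := mul_le_mul_of_nonneg_left hM (pow_nonneg (sq_nonneg (rhoPin δ)) (n + 1))
  refine le_of_eq_of_le ?_ (h2.trans_eq ?_) <;> ring


/-! ### The limiting doubled configuration is non-coincident -/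

/-- The continuum doubled configuration `(θ_∞B₀, B₀)`, `B₀ = (x₀ l)_{l ≠ i}`, `θ_∞` the reflection
in the plane `{p_τ = m₀}`, is non-coincident when `x₀` is and all points of `B₀` lie on one strict
side of the plane. [folklore] -/
theorem doubled_mem_nonCoincident {n : ℕ} (i : Fin (n + 1)) (τ : Fin 3)
    {x₀ : Fin (n + 1) → EuclideanSpace ℝ (Fin 3)} (hinj : Injective x₀) {m₀ : ℝ}
    (hside₀ : (∀ l, l ≠ i → m₀ < x₀ l τ) ∨ (∀ l, l ≠ i → x₀ l τ < m₀)) :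
    (Fin.append
        (fun l => (WithLp.toLp 2 fun q => if q = τ then 2 * m₀ - x₀ (i.succAbove l) τ
          else x₀ (i.succAbove l) q : EuclideanSpace ℝ (Fin 3)))
        (fun l => x₀ (i.succAbove l)) : Fin (n + n) → EuclideanSpace ℝ (Fin 3)) ∈
      NonCoincident 3 (n + n) := by
  rw [mem_nonCoincident]
  -- the `τ`-coordinates of the two blocks are separated by the plane
  have hsep : ∀ l l' : Fin n, 2 * m₀ - x₀ (i.succAbove l) τ ≠ x₀ (i.succAbove l') τ := by
    intro l l' h
    rcases hside₀ with hs | hs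
    · have h1 := hs _ (Fin.succAbove_ne i l)
      have h2 := hs _ (Fin.succAbove_ne i l')
      linarith
    · have h1 := hs _ (Fin.succAbove_ne i l)
      have h2 := hs _ (Fin.succAbove_ne i l')
      linarith
  intro a b hab
  induction a using Fin.addCases with
  | left l =>
    induction b using Fin.addCases with
    | left l' =>
      simp only [Fin.append_left] at hab
      have h : x₀ (i.succAbove l) = x₀ (i.succAbove l') := by
        ext q
        have hq' := congrArg (fun p : EuclideanSpace ℝ (Fin 3) => p q) hab
        by_cases hq : q = τ
        · subst hq
          simp only [if_true] at hq'
          linarith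
        · simpa only [if_neg hq] using hq'
      rw [Fin.succAbove_right_injective (hinj h)]
    | right l' =>
      simp only [Fin.append_left, Fin.append_right] at hab
      have hq' := congrArg (fun p : EuclideanSpace ℝ (Fin 3) => p τ) hab
      simp only [if_true] at hq'
      exact absurd hq' (hsep l l')
  | right l =>
    induction b using Fin.addCases with
    | left l' =>
      simp only [Fin.append_left, Fin.append_right] at hab
      have hq' := congrArg (fun p : EuclideanSpace ℝ (Fin 3) => p τ) hab
      simp only [if_true] at hq'
      exact absurd hq'.symm (hsep l' l)
    | right l' =>
      simp only [Fin.append_right] at hab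
      rw [Fin.succAbove_right_injective (hinj hab)]

/-! ### From sequences to the uniform statement -/

/-- **Asymptotic equicontinuity from its sequential form** (pure topology). If for all sequences
`x_j, x'_j` in the compact `K`, related by `P`, converging to a common limit in `K`, and every
strictly increasing `φ`, `F (φ j) x_j − F (φ j) x'_j → 0`, then for every `ε > 0` there is `η > 0`
with `|F k x − F k x'| < ε` eventually in `k`, for all `P`-related `x, x' ∈ K` at distance `< η`:
otherwise extract (`extraction_forall_of_frequently`) indices `φ j` and pairs at distance `< 1/(j+1)`
with `|F (φ j) x_j − F (φ j) x'_j| ≥ ε`, and a convergent subsequence (`IsCompact.tendsto_subseq`).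
[folklore] -/
theorem equicontinuity_of_seq :
    ∀ (N : ℕ) (K : Set (Fin N → EuclideanSpace ℝ (Fin 3))), IsCompact K →
      ∀ (P : (Fin N → EuclideanSpace ℝ (Fin 3)) → (Fin N → EuclideanSpace ℝ (Fin 3)) → Prop)
        (F : ℕ → (Fin N → EuclideanSpace ℝ (Fin 3)) → ℝ),
        (∀ (x x' : ℕ → Fin N → EuclideanSpace ℝ (Fin 3)) (x₀ : Fin N → EuclideanSpace ℝ (Fin 3)),
          x₀ ∈ K → (∀ j, P (x j) (x' j)) → Tendsto x atTop (𝓝 x₀) → Tendsto x' atTop (𝓝 x₀) →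
          ∀ φ : ℕ → ℕ, StrictMono φ →
            Tendsto (fun j => F (φ j) (x j) - F (φ j) (x' j)) atTop (𝓝 0)) →
        ∀ ε > 0, ∃ η > 0, ∀ᶠ k in atTop, ∀ x ∈ K, ∀ x' ∈ K, P x x' → dist x x' < η →
          |F k x - F k x'| < ε := by
  intro N K hK P F hseq ε hε
  by_contra hcon
  have hfreq : ∀ m : ℕ, ∃ᶠ k in atTop, ∃ x ∈ K, ∃ x' ∈ K, P x x' ∧
      dist x x' < 1 / ((m : ℝ) + 1) ∧ ε ≤ |F k x - F k x'| := by
    intro m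
    have hm : ¬ ∀ᶠ k in atTop, ∀ x ∈ K, ∀ x' ∈ K, P x x' → dist x x' < 1 / ((m : ℝ) + 1) →
        |F k x - F k x'| < ε := fun h => hcon ⟨1 / ((m : ℝ) + 1), Nat.one_div_pos_of_nat, h⟩
    rw [not_eventually] at hm
    refine hm.mono fun k hk => ?_
    push Not at hk
    exact hk
  obtain ⟨φ, hφ, hφP⟩ := extraction_forall_of_frequently hfreq
  choose x hxK x' hx'K hP hdist hge using hφP
  obtain ⟨x₀, hx₀, ψ, hψ, hlim⟩ := hK.tendsto_subseq hxK
  have hlim' : Tendsto (x' ∘ ψ) atTop (𝓝 x₀) := by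
    refine hlim.congr_dist (squeeze_zero (fun m => dist_nonneg) (fun m => ?_)
      tendsto_one_div_add_atTop_nhds_zero_nat)
    refine (hdist (ψ m)).le.trans (one_div_le_one_div_of_le (by positivity) ?_)
    exact_mod_cast Nat.add_le_add_right hψ.le_apply 1
  have h := (hseq (x ∘ ψ) (x' ∘ ψ) x₀ hx₀ (fun m => hP (ψ m)) hlim hlim' (φ ∘ ψ) (hφ.comp hψ)).abs
  rw [abs_zero] at h
  obtain ⟨m, hm⟩ := (h.eventually (gt_mem_nhds hε)).exists
  simp only [Function.comp_apply] at hm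
  exact absurd hm (not_lt.2 (hge (ψ m)))

end Summit.CriticalPhenomena.Ising3DConformalLimit.MoebiusLimitExistsOnlyInteraction

end
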